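import Summits.AtomisticToContinuum.Crystallization.Theorems.ThreeConeCertificateExactCertificateTransfer1DPositional

/-!
# Crux `ExactCertificate` (stmt-AtomisticToContinuum-11959), line `closure-makes-nogap-exact`: TRANSFER THEOREM III —
# bulk defects of Lennard-Jones ground states on a line are O(1) (`BulkDefectVanish` with `3 ↦ 1`, with a rate)

Support file (`--supports stmt-AtomisticToContinuum-11959`); nothing here closes the 3-D crux (`NoGap ∧ KeplerBound`,
`KeplerBound` = item 11961 ↔ 0627, open).  The route's second half reads `SlackRigidity → BulkDefectVanish (hinge 0751) →
DefectVanishCrystallizes → IsCrystallizing`; this file proves the d = 1 analogue of the SHARED HINGE `BulkDefectVanish`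
(item 0751, the statement with `3 ↦ 1`, verbatim otherwise) — and more: the number of particles of a ground state of `N`
Lennard-Jones particles on a line whose `R`-environment is NOT `ε`-matched (both ways, by a linear isometry, here the
identity) to the chain `aℤ` is BOUNDED INDEPENDENTLY OF `N` (`pos1d_card_bad_le`), hence `o(N)`
(`bulkDefectVanish_lennardJones_one`).

Mechanism: the structure theorem `pos1d_groundState_structure` (`…Transfer1DPositional.lean`: sorted ground states have all
gaps in `[3/4, 1]` and `Σ_i (gap_i − a)² ≤ C`, uniformly in `N`).  With `K = ⌈4R/3⌉ + 1` and `η = ε/K`: at most `C/η²` gaps are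
`η`-bad (Chebyshev); a rank `j` with `K ≤ j < N − K` and no `η`-bad gap within index distance `K` has its `R`-environment
`ε`-matched to `aℤ` (`stub_blockMatching`: cumulative separation `¾|i − j|` confines the `R`-environment to ranks
`|i − j| ≤ 4R/3 < K`, cumulative closeness gives `|y_i − y_j − (i − j)a| ≤ Kη = ε`); every other rank is within `K` of an
end or of a bad gap: at most `2K + 2K·C/η²` of them.
-/

noncomputable section

namespace Summit.AtomisticToContinuum.Crystallization.Theorems.ThreeConeCertificateExactCertificate.Transfer1D

open Literature.MathematicalPhysics.StatisticalMechanics MeasureTheory Set Filter Topology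
open scoped BigOperators

/-- Chebyshev count: if `Σ_{i<n} η_i² ≤ C` then at most `C/δ²` indices have `δ < |η_i|`. [folklore] -/
theorem pos1d_card_badGap_le (n : ℕ) (η : ℕ → ℝ) (C δ : ℝ) (hδ : 0 < δ)
    (hC : ∑ i ∈ Finset.range n, η i ^ 2 ≤ C) :
    ((((Finset.range n).filter fun i => δ < |η i|).card : ℕ) : ℝ) ≤ C / δ ^ 2 := by
  rw [le_div_iff₀ (by positivity)]
  calc ((((Finset.range n).filter fun i => δ < |η i|).card : ℕ) : ℝ) * δ ^ 2
      = ∑ _i ∈ (Finset.range n).filter (fun i => δ < |η i|), δ ^ 2 := by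
        rw [Finset.sum_const, nsmul_eq_mul]
    _ ≤ ∑ i ∈ (Finset.range n).filter (fun i => δ < |η i|), η i ^ 2 := by
        refine Finset.sum_le_sum fun i hi => ?_
        have h := (Finset.mem_filter.1 hi).2
        have : δ ^ 2 < |η i| ^ 2 := by gcongr
        rw [sq_abs] at this
        exact this.le
    _ ≤ ∑ i ∈ Finset.range n, η i ^ 2 :=
        Finset.sum_le_sum_of_subset_of_nonneg (Finset.filter_subset _ _) fun i _ _ => sq_nonneg _
    _ ≤ C := hC

/-- Window count: for `l K : ℕ`, at most `2K` ranks `j < N` satisfy `j ≤ l + K ∧ l < j + K`. [folklore] -/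
theorem pos1d_card_window_le (N l K : ℕ) :
    ((Finset.univ.filter fun j : Fin N => (j : ℕ) ≤ l + K ∧ l < (j : ℕ) + K).card) ≤ 2 * K := by
  calc (Finset.univ.filter fun j : Fin N => (j : ℕ) ≤ l + K ∧ l < (j : ℕ) + K).card
      = ((Finset.univ.filter fun j : Fin N => (j : ℕ) ≤ l + K ∧ l < (j : ℕ) + K).image Fin.val).card :=
        (Finset.card_image_of_injective _ Fin.val_injective).symm
    _ ≤ (Finset.Ico (l + 1 - K) (l + K + 1)).card := by
        refine Finset.card_le_card fun m hm => ?_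
        simp only [Finset.mem_image, Finset.mem_filter, Finset.mem_univ, true_and] at hm
        obtain ⟨j, ⟨h1, h2⟩, rfl⟩ := hm
        rw [Finset.mem_Ico]
        omega
    _ ≤ 2 * K := by rw [Nat.card_Ico]; omega

/-- **The bad particles of a one-dimensional Lennard-Jones ground state are O(1).**  With the data of
`pos1d_groundState_structure` (lattice constant `a ∈ [3/4,1]`, defect constant `C`, the chain `P = aℤ` enumerated by `e`),
for every `R, ε > 0` and every ground state `x` of `N` particles, the number of particles `i` whose `R`-environment is not
two-way `ε`-matched to `x_i + aℤ` is at most `2K + 2K·C/η²`, `K = ⌈4R/3⌉ + 1`, `η = ε/K`. [folklore] -/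
theorem pos1d_card_bad_le {a C : ℝ} {P : PeriodicConfiguration 1} (e : ℤ ≃ P.points) (ha34 : 3 / 4 ≤ a)
    (he : ∀ k : ℤ, ((e k : P.points) : EuclideanSpace ℝ (Fin 1)) = EuclideanSpace.single (0 : Fin 1) ((k : ℝ) * a))
    {R ε : ℝ} (hR : 0 < R) (hε : 0 < ε) {N : ℕ} {x : Fin N → EuclideanSpace ℝ (Fin 1)}
    (σ : Equiv.Perm (Fin N)) (y : ℕ → ℝ)
    (hyx : ∀ i : Fin N, x (σ i) = EuclideanSpace.single (0 : Fin 1) (y i))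
    (hlo : ∀ i : ℕ, i + 1 < N → 3 / 4 ≤ y (i + 1) - y i)
    (hsq : ∑ i ∈ Finset.range (N - 1), (a - (y (i + 1) - y i)) ^ 2 ≤ C) :
    ((Nat.card {i : Fin N // ¬ ∃ A : EuclideanSpace ℝ (Fin 1) →ₗᵢ[ℝ] EuclideanSpace ℝ (Fin 1),
        (∀ p ∈ P.points, ‖p‖ ≤ R → ∃ j : Fin N, dist (x j) (x i + A p) ≤ ε) ∧
        (∀ j : Fin N, dist (x j) (x i) ≤ R → ∃ p ∈ P.points, dist (x j) (x i + A p) ≤ ε)} : ℕ) : ℝ) ≤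
      2 * (⌈4 * R / 3⌉₊ + 1 : ℕ) + 2 * (⌈4 * R / 3⌉₊ + 1 : ℕ) * (C / (ε / (⌈4 * R / 3⌉₊ + 1 : ℕ)) ^ 2) := by
  classical
  set K : ℕ := ⌈4 * R / 3⌉₊ + 1 with hKdef
  set η : ℝ := ε / K with hηdef
  have hK1 : (1 : ℝ) ≤ K := by
    simp only [hKdef]; push_cast; linarith [(Nat.cast_nonneg (⌈4 * R / 3⌉₊) : (0 : ℝ) ≤ _)]
  have hKpos : (0 : ℝ) < K := by linarith
  have hη : 0 < η := div_pos hε hKpos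
  have hKη : (K : ℝ) * η = ε := by simp only [hηdef]; field_simp
  have hRK : 4 * R / 3 + 1 ≤ K := by
    simp only [hKdef]; push_cast; linarith [Nat.le_ceil (4 * R / 3)]
  have ha : 0 < a := by linarith
  -- coordinates of the particles
  have hcoord : ∀ i : Fin N, x i 0 = y ((σ.symm i : Fin N) : ℕ) := fun i => by
    have h1 := hyx (σ.symm i)
    rw [Equiv.apply_symm_apply] at h1
    rw [h1]
    simp only [PiLp.single_apply, if_true]
  -- the bad predicate and the bad ranks
  let Q : Fin N → Prop := fun i => ¬ ∃ A : EuclideanSpace ℝ (Fin 1) →ₗᵢ[ℝ] EuclideanSpace ℝ (Fin 1),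
        (∀ p ∈ P.points, ‖p‖ ≤ R → ∃ j : Fin N, dist (x j) (x i + A p) ≤ ε) ∧
        (∀ j : Fin N, dist (x j) (x i) ≤ R → ∃ p ∈ P.points, dist (x j) (x i + A p) ≤ ε)
  let badGap : ℕ → Prop := fun l => η < |a - (y (l + 1) - y l)|
  let T : Finset (Fin N) := Finset.univ.filter fun j : Fin N =>
    (j : ℕ) < K ∨ N ≤ (j : ℕ) + K ∨ ∃ l : ℕ, l + 1 < N ∧ badGap l ∧ (j : ℕ) ≤ l + K ∧ l < (j : ℕ) + K
  -- (i) a rank outside `T` is a good particle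
  have hgood : ∀ j : Fin N, j ∉ T → ¬ Q (σ j) := by
    intro j hjT hQ
    simp only [T, Finset.mem_filter, Finset.mem_univ, true_and, not_or, not_lt, not_le, not_exists, not_and] at hjT
    obtain ⟨hjK, hjN, hjl⟩ := hjT
    have hblk : ∀ i : ℕ, (j : ℕ) - K ≤ i → i < (j : ℕ) + K → |y (i + 1) - y i - a| ≤ η := by
      intro i hi1 hi2
      rw [abs_sub_comm]
      by_contra hbad
      have := hjl i (by omega) (not_le.1 hbad) (by omega)
      omega
    obtain ⟨hfar, hnear⟩ := stub_blockMatching N j K y a η hlo hblk hjK hjN hη.le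
    apply hQ
    refine ⟨LinearIsometry.id, fun p hp hpR => ?_, fun j' hj' => ?_⟩
    · -- sites → particles
      obtain ⟨k, hk⟩ := e.surjective ⟨p, hp⟩
      have hpk : p = EuclideanSpace.single (0 : Fin 1) ((k : ℝ) * a) := by
        have h1 := he k; rw [hk] at h1; exact h1
      have hkabs : |(k : ℝ)| ≤ 4 * R / 3 := by
        rw [hpk, StickyChain.norm_eq_abs] at hpR
        simp only [PiLp.single_apply, if_true, abs_mul, abs_of_pos ha] at hpR
        have h1 : |(k : ℝ)| ≤ R / a := (le_div_iff₀ ha).2 hpR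
        have h2 : R / a ≤ R / (3 / 4) := div_le_div_of_nonneg_left hR.le (by norm_num) ha34
        linarith
      obtain ⟨hk1, hk2⟩ := abs_le.1 (show |(k : ℝ)| ≤ K by linarith)
      have hk1' : -(K : ℤ) ≤ k := by exact_mod_cast hk1
      have hk2' : k ≤ (K : ℤ) := by exact_mod_cast hk2
      obtain ⟨i, hi⟩ : ∃ i : ℕ, (i : ℤ) = (j : ℤ) + k :=
        ⟨Int.toNat ((j : ℤ) + k), Int.toNat_of_nonneg (by omega)⟩
      have hiN : i < N := by omega
      have hiR : (i : ℝ) - (j : ℕ) = k := by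
        have h1 : ((i : ℤ) : ℝ) = ((((j : ℕ) : ℤ) + k : ℤ) : ℝ) := by rw [hi]
        push_cast at h1
        linarith
      refine ⟨σ ⟨i, hiN⟩, ?_⟩
      rw [StickyChain.dist_eq_abs_sub, hcoord, Equiv.symm_apply_apply, PiLp.add_apply, hcoord,
        Equiv.symm_apply_apply, LinearIsometry.id_apply, hpk]
      simp only [PiLp.single_apply, if_true]
      have h1 := hnear i (by omega) (by omega)
      rw [hiR] at h1
      calc |y i - (y (j : ℕ) + (k : ℝ) * a)| = |y i - y (j : ℕ) - (k : ℝ) * a| := by ring_nf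
        _ ≤ K * η := h1
        _ = ε := hKη
    · -- particles → sites
      set i : ℕ := ((σ.symm j' : Fin N) : ℕ) with hidef
      have hiN : i < N := (σ.symm j').2
      rw [StickyChain.dist_eq_abs_sub, hcoord, hcoord, Equiv.symm_apply_apply] at hj'
      have hij : |(i : ℝ) - (j : ℕ)| ≤ 4 * R / 3 := by
        have h1 := hfar i hiN
        rw [← hidef] at hj'
        linarith
      have hiblk : (j : ℕ) - K ≤ i ∧ i ≤ (j : ℕ) + K := by
        obtain ⟨h1, h2⟩ := abs_le.1 hij
        constructor
        · by_contra hlt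
          have h' : i + K + 1 ≤ (j : ℕ) := by omega
          have h'' : (i : ℝ) + K + 1 ≤ (j : ℕ) := by exact_mod_cast h'
          linarith
        · by_contra hlt
          have h' : (j : ℕ) + K + 1 ≤ i := by omega
          have h'' : ((j : ℕ) : ℝ) + K + 1 ≤ i := by exact_mod_cast h'
          linarith
      refine ⟨(e ((i : ℤ) - (j : ℕ)) : EuclideanSpace ℝ (Fin 1)), (e _).2, ?_⟩
      rw [StickyChain.dist_eq_abs_sub, hcoord, PiLp.add_apply, hcoord, Equiv.symm_apply_apply,
        LinearIsometry.id_apply, he]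
      simp only [PiLp.single_apply, if_true]
      have h1 := hnear i hiblk.1 hiblk.2
      rw [← hidef]
      push_cast
      calc |y i - (y (j : ℕ) + ((i : ℝ) - (j : ℕ)) * a)| = |y i - y (j : ℕ) - ((i : ℝ) - (j : ℕ)) * a| := by ring_nf
        _ ≤ K * η := h1
        _ = ε := hKη
  -- (ii) counting: the bad particles inject into `T`
  have hcardQ : Nat.card {i : Fin N // Q i} ≤ T.card := by
    rw [Nat.card_eq_fintype_card, Fintype.card_subtype]
    calc (Finset.univ.filter fun i => Q i).card ≤ (T.image σ).card := by
          refine Finset.card_le_card fun i hi => ?_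
          rw [Finset.mem_filter] at hi
          rw [Finset.mem_image]
          refine ⟨σ.symm i, ?_, σ.apply_symm_apply i⟩
          by_contra hT
          exact hgood (σ.symm i) hT (by rw [σ.apply_symm_apply]; exact hi.2)
      _ ≤ T.card := Finset.card_image_le
  -- (iii) counting `T`
  set B : Finset ℕ := (Finset.range (N - 1)).filter fun l => η < |a - (y (l + 1) - y l)| with hBdef
  have hBcard : ((B.card : ℕ) : ℝ) ≤ C / η ^ 2 := pos1d_card_badGap_le (N - 1) _ C η hη hsq
  have hTcard : T.card ≤ K + K + B.card * (2 * K) := by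
    have hsub : T ⊆ (Finset.univ.filter fun j : Fin N => (j : ℕ) < K) ∪
        (Finset.univ.filter fun j : Fin N => N ≤ (j : ℕ) + K) ∪
        B.biUnion (fun l => Finset.univ.filter fun j : Fin N => (j : ℕ) ≤ l + K ∧ l < (j : ℕ) + K) := by
      intro j hj
      simp only [T, Finset.mem_filter, Finset.mem_univ, true_and] at hj
      simp only [Finset.mem_union, Finset.mem_filter, Finset.mem_univ, true_and, Finset.mem_biUnion, hBdef,
        Finset.mem_range]
      rcases hj with h | h | ⟨l, hl1, hl2, hl3, hl4⟩
      · exact Or.inl (Or.inl h)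
      · exact Or.inl (Or.inr h)
      · exact Or.inr ⟨l, ⟨by omega, hl2⟩, hl3, hl4⟩
    refine (Finset.card_le_card hsub).trans ?_
    refine (Finset.card_union_le _ _).trans (add_le_add ((Finset.card_union_le _ _).trans (add_le_add ?_ ?_)) ?_)
    · calc (Finset.univ.filter fun j : Fin N => (j : ℕ) < K).card
          = ((Finset.univ.filter fun j : Fin N => (j : ℕ) < K).image Fin.val).card :=
            (Finset.card_image_of_injective _ Fin.val_injective).symm
        _ ≤ (Finset.range K).card := by
            refine Finset.card_le_card fun m hm => ?_
            simp only [Finset.mem_image, Finset.mem_filter, Finset.mem_univ, true_and] at hm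
            obtain ⟨j, h1, rfl⟩ := hm
            exact Finset.mem_range.2 h1
        _ = K := Finset.card_range K
    · calc (Finset.univ.filter fun j : Fin N => N ≤ (j : ℕ) + K).card
          = ((Finset.univ.filter fun j : Fin N => N ≤ (j : ℕ) + K).image Fin.val).card :=
            (Finset.card_image_of_injective _ Fin.val_injective).symm
        _ ≤ (Finset.Ico (N - K) N).card := by
            refine Finset.card_le_card fun m hm => ?_
            simp only [Finset.mem_image, Finset.mem_filter, Finset.mem_univ, true_and] at hm
            obtain ⟨j, h1, rfl⟩ := hm
            rw [Finset.mem_Ico]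
            omega
        _ ≤ K := by rw [Nat.card_Ico]; omega
    · exact Finset.card_biUnion_le.trans (Finset.sum_le_card_nsmul _ _ _ fun l _ => pos1d_card_window_le N l K)
  -- (iv) assemble in `ℝ`
  have h1 : ((Nat.card {i : Fin N // Q i} : ℕ) : ℝ) ≤ (T.card : ℝ) := by exact_mod_cast hcardQ
  have h2 : ((T.card : ℕ) : ℝ) ≤ K + K + B.card * (2 * K) := by exact_mod_cast hTcard
  have h3 : (B.card : ℝ) * (2 * K) ≤ C / η ^ 2 * (2 * K) := mul_le_mul_of_nonneg_right hBcard (by positivity)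
  calc ((Nat.card {i : Fin N // Q i} : ℕ) : ℝ) ≤ K + K + B.card * (2 * K) := h1.trans h2
    _ ≤ K + K + C / η ^ 2 * (2 * K) := by linarith
    _ = 2 * (K : ℝ) + 2 * K * (C / η ^ 2) := by ring

/-- **BULK DEFECTS OF LENNARD-JONES GROUND STATES ON A LINE VANISH** — the route's shared hinge `BulkDefectVanish`
(item 0751) with `3 ↦ 1`, verbatim otherwise: there is one periodic configuration `P` of `ℝ¹` (the zero-pressure chain `aℤ`)
such that for every window radius `R` and tolerance `ε`, along every sequence of ground states all but `o(N)` particles have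
their `R`-environment two-way `ε`-matched to a linear-isometric copy of `P` attached at the particle (here: the identity,
and all but O(1) particles). [folklore] -/
theorem bulkDefectVanish_lennardJones_one :
    ∃ P : PeriodicConfiguration 1, ∀ R ε : ℝ, 0 < R → 0 < ε →
      ∀ x : (N : ℕ) → (Fin N → EuclideanSpace ℝ (Fin 1)), (∀ N, IsGroundState lennardJones (x N)) →
        Tendsto (fun N : ℕ => (Nat.card {i : Fin N // ¬ ∃ A : EuclideanSpace ℝ (Fin 1) →ₗᵢ[ℝ] EuclideanSpace ℝ (Fin 1),
            (∀ p ∈ P.points, ‖p‖ ≤ R → ∃ j : Fin N, dist (x N j) (x N i + A p) ≤ ε) ∧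
            (∀ j : Fin N, dist (x N j) (x N i) ≤ R → ∃ p ∈ P.points, dist (x N j) (x N i + A p) ≤ ε)} : ℝ) / N)
          atTop (𝓝 0) := by
  obtain ⟨a, C, P, e, ha34, _ha1, he, hstruct⟩ := pos1d_groundState_structure
  refine ⟨P, fun R ε hR hε x hx => ?_⟩
  have hstructN := fun N => hstruct N (x N) (hx N)
  choose σ y _hymono hyx hlo _hhi hsq using hstructN
  set B : ℝ := 2 * (⌈4 * R / 3⌉₊ + 1 : ℕ) + 2 * (⌈4 * R / 3⌉₊ + 1 : ℕ) * (C / (ε / (⌈4 * R / 3⌉₊ + 1 : ℕ)) ^ 2) with hB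
  have hbound : ∀ N, ((Nat.card {i : Fin N // ¬ ∃ A : EuclideanSpace ℝ (Fin 1) →ₗᵢ[ℝ] EuclideanSpace ℝ (Fin 1),
        (∀ p ∈ P.points, ‖p‖ ≤ R → ∃ j : Fin N, dist (x N j) (x N i + A p) ≤ ε) ∧
        (∀ j : Fin N, dist (x N j) (x N i) ≤ R → ∃ p ∈ P.points, dist (x N j) (x N i + A p) ≤ ε)} : ℕ) : ℝ) ≤ B :=
    fun N => pos1d_card_bad_le e ha34 he hR hε (σ N) (y N) (hyx N) (hlo N) (hsq N)
  have hlim : Tendsto (fun N : ℕ => B / (N : ℝ)) atTop (𝓝 0) := tendsto_const_nhds.div_atTop tendsto_natCast_atTop_atTop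
  refine tendsto_of_tendsto_of_tendsto_of_le_of_le' tendsto_const_nhds hlim ?_ ?_
  · exact Filter.Eventually.of_forall fun N => by positivity
  · filter_upwards [Filter.eventually_ge_atTop 1] with N hN
    exact div_le_div_of_nonneg_right (hbound N) (by positivity)

end Summit.AtomisticToContinuum.Crystallization.Theorems.ThreeConeCertificateExactCertificate.Transfer1D

end
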